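import Summits.Ventures.QEC.Thresholds.ToricCodePhenomenologicalThresholds
import Literature.InformationTheory.QuantumCodes.ToricCodePhenomenologicalClusterBound
import HarnessLib

/-!
# Phenomenological toric threshold `p₀(5) = (5 - 2√6)/10 ≈ .0101`, now UNCONDITIONAL

Venture QEC, `Summits/Ventures/QEC/Thresholds/` (LADDER-QEC rung Q5, phenomenological `q = p`; qec-lit-2
gen 3). `ToricCodePhenomenologicalThresholds.lean` (qec-type-09) states `phenomThreshold_elementary` —
threshold `≥ p₀(5)` for every polynomially bounded schedule and every minimum-weight space-time decoder
family — CONDITIONAL on the named fact `ToricCode.phenomThreshold_of_sawCountBound` (hypothesis `h`). The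
Literature theorem `ToricCode.phenomThreshold_cluster` (`ToricCodePhenomenologicalClusterBound.lean`:
Dumer–Kovalev–Pryadko irreducible clusters on the space-time code, check weight `6`, growth `5`) proves
exactly this `ν = 5` instance WITHOUT the fact. This file packages it in the cell's vocabulary: the same
statements as type-09's `phenomThreshold_elementary` / `ToricCode.phenomThreshold_stMinWeight` /
`phenom_accuracyThreshold_ge_elementary` with the hypothesis `h` REMOVED (tier CERTIFIED, kernel axioms, no
named fact, no `native_decide`). The better tiers `p₀(4.684) ≈ .0111` (automaton, native) and
`p₀(4.7387) > .0112` (Pönitz–Tittmann, conditional) still go through the undischarged parametric fact; the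
independent unconditional constant `1/40000` of `ToricCodePhenomenologicalCluster.lean` (animal route) is
superseded by `p₀(5)` here.

## References

* [DennisEtAl2002] E. Dennis, A. Kitaev, A. Landahl, J. Preskill, *Topological quantum memory*,
  J. Math. Phys. 43 (2002) 4452, §5.3 eqs. (threshold_iso), (threshold_iso_num).
* [DumerKovalevPryadko2015] I. Dumer, A. A. Kovalev, L. P. Pryadko, PRL 115 (2015) 050502, Thm. 2/3
  (irreducible-cluster thresholds; "w → w + 2" for the phenomenological model).
-/

noncomputable section

namespace Summit.Ventures.QEC.Thresholds

open Filter Topology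
open Literature.InformationTheory.QuantumCodes
open Literature.InformationTheory.QuantumCodes.ToricCode

/-- **UNCONDITIONAL phenomenological threshold `≥ p₀(5)`**: for every polynomially bounded schedule of
rounds and every family of minimum-weight space-time decoders of the toric codes, under independent qubit
errors `p` per round AND independent syndrome-measurement errors `q = p` per round,
`p₀(5) = (1 - √(1 - 1/25))/2` is a lower bound on the accuracy threshold (`Prob_fail → 0` for all
`0 ≤ p < p₀(5)`). No named fact. [cite: DennisEtAl2002, §5.3 eqs. (threshold_iso), (threshold_iso_num)] -/
theorem phenomThreshold_elementary_unconditional {T : ℕ → ℕ} (hT : IsPolyBounded T)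
    {D : (L : ℕ) → STDecoder (L + 1) (T L)}
    (hD : ∀ L, (D L).IsMinWeight (stSyn (L + 1) (T L)) (stCycles (L + 1) (T L)) hammingNorm) :
    IsThresholdLowerBound (phenomFailureFamily T D) (thresholdValue 5) := by
  intro p hp₀ hpp
  have hp : p ≤ 1 / 2 := le_trans hpp.le (thresholdValue_le_half 5)
  -- `p < p₀(5)` and `p + p₀(5) < 1` give `100 p(1-p) < 100 p₀(1-p₀) = 1`
  have h100 : 100 * (p * (1 - p)) < 1 := by
    have hsum : p + thresholdValue 5 < 1 := by
      have := thresholdValue_le_half 5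
      linarith
    have hlt := mul_one_sub_lt_mul_one_sub hpp hsum
    have h := four_mul_sq_mul_thresholdValue (ν := 5) (by norm_num)
    nlinarith
  exact ToricCode.phenomThreshold_cluster T hT D hD hp₀ hp h100

/-- The canonical instance (schedule `T = L + 1`, the minimum-weight space-time decoder
`Decoder.minWeight`), UNCONDITIONAL. [cite: DennisEtAl2002, §5.3 eq. (threshold_iso_num)] -/
theorem ToricCode.phenomThreshold_stMinWeight_unconditional :
    IsThresholdLowerBound
      (phenomFailureFamily (fun L => L + 1)
        fun L => Decoder.minWeight (stSyn (L + 1) (L + 1)) hammingNorm)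
      (thresholdValue 5) :=
  phenomThreshold_elementary_unconditional isPolyBounded_succ
    fun L => ToricCode.isMinWeight_stMinWeight (L + 1) (L + 1)

/-- **`p_c ≥ (5 - 2√6)/10 ≈ .0101`** under phenomenological noise (`q = p`), UNCONDITIONAL, for every
minimum-weight space-time decoder family and every polynomially bounded schedule.
[cite: DennisEtAl2002, §5.3 eqs. (saw_d), (threshold_iso_num)] -/
theorem phenom_accuracyThreshold_ge_elementary_unconditional {T : ℕ → ℕ} (hT : IsPolyBounded T)
    {D : (L : ℕ) → STDecoder (L + 1) (T L)}
    (hD : ∀ L, (D L).IsMinWeight (stSyn (L + 1) (T L)) (stCycles (L + 1) (T L)) hammingNorm) :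
    (5 - 2 * Real.sqrt 6) / 10 ≤ accuracyThreshold (phenomFailureFamily T D) := by
  rw [← thresholdValue_five]
  exact le_accuracyThreshold (phenomThreshold_elementary_unconditional hT hD)
    ((thresholdValue_le_half 5).trans (by norm_num))

/-- Decimal, UNCONDITIONAL: `.0101 < p_c` under phenomenological noise (`q = p`).
[cite: DennisEtAl2002, §5.3 eq. (threshold_iso_num)] -/
theorem phenom_accuracyThreshold_gt_0101 {T : ℕ → ℕ} (hT : IsPolyBounded T)
    {D : (L : ℕ) → STDecoder (L + 1) (T L)}
    (hD : ∀ L, (D L).IsMinWeight (stSyn (L + 1) (T L)) (stCycles (L + 1) (T L)) hammingNorm) :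
    (0.0101 : ℝ) < accuracyThreshold (phenomFailureFamily T D) :=
  lt_of_lt_of_le thresholdValue_five_bounds.1
    (le_accuracyThreshold (phenomThreshold_elementary_unconditional hT hD)
      ((thresholdValue_le_half 5).trans (by norm_num)))

end Summit.Ventures.QEC.Thresholds
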